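import Literature.RepresentationTheory.HeisenbergGroup.SchwartzBruhatLatticeUncertainty
import Literature.RepresentationTheory.HeisenbergGroup.SchrodingerPartialFourierWeyl
import HarnessLib

/-!
# The integral uncertainty principle keyed on the AUTOMORPHISM `𝓕_{x′} ⊠ 1 = boxEquivSB K e (piFourierEquivSB μ₁ hψ hm) 1`

Topic `RepresentationTheory/HeisenbergGroup`; namespace `Literature.RepresentationTheory.HeisenbergGroup`.  KERNEL ONLY: theorems;
no definition, no named fact, no record, no `sorry`.  Socket adapter between
* ★ `SchwartzBruhatLatticeUncertainty` (δ1: `eq_zero_of_resL_support_subset_box_of_partialFourier(_symm)_mulChar_eigen`, keyed on the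
  ENDOMORPHISM `sumEndSB K e (piFourierEquivSB μ₁ hψ hm)(.symm).toLinearMap LinearMap.id` and the eigen-identity `ψ(b·Q₂) · g = l · g`), and
* ★ `SchrodingerPartialFourierWeyl.implements_partialWeyl_boxFourier` (the partial Weyl element is implemented by the AUTOMORPHISM
  `boxEquivSB K e (piFourierEquivSB μ₁ hψ hm) (LinearEquiv.refl ℂ _)`) together with ★ `EigenvectorSiegelTransport` (δ2-T: the
  eigen-identity comes out as `g x · ψ(t·Q(x|ι₁)) = κ · g x`, for `g = ℱ.symm (toOp q f)`),
so that road δ's δ2 can feed its hypotheses VERBATIM.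

* §1 `coe_boxEquivSB_symm_eq_sumEndSB` — `(M₁ ⊠ M₂)⁻¹ = M₁⁻¹ ⊠ M₂⁻¹` as linear maps (products + `linearMap_ext_boxSB`), and the
  `refl` specialisations `boxEquivSB K e M 1 = sumEndSB K e M id`, `(boxEquivSB K e M 1).symm = sumEndSB K e M.symm id` on elements.
* §2 `eq_zero_of_resL_support_subset_box_of_boxFourier_symm_eigen` ∕ `…_boxFourier_eigen` — δ1 (δ1b) in both orientations for
  `ℱ = boxEquivSB K e (piFourierEquivSB μ₁ hψ hm) (LinearEquiv.refl ℂ _)`, eigen-identity in δ2-T's product order.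

Consumer: cell `hodgecm-mathlib`, crux H413, P2 road δ (δ2 `eq_zero_of_forall_implementer_eigen_of_odd`).  Folklore bookkeeping
([MoeglinVignerasWaldspurger1987, Chap. 2 II.1 Rem. (6), II.6]); nothing of the cited source is asserted.  HC_CM is proved only modulo
the 7 printed citations until rung 0 closes; this file proves nothing about them.

## References
* [MoeglinVignerasWaldspurger1987] C. Mœglin, M.-F. Vignéras, J.-L. Waldspurger, LNM 1291 (1987), Chap. 2 II.1 Rem. (6), II.6.
* [WeilBNT1967] A. Weil, *Basic Number Theory* (1967), Chap. VII §2 Prop. 2.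
-/

set_option autoImplicit false

open MeasureTheory
open Literature.NumberTheory.Automorphic
open Literature.NumberTheory.GaloisRepresentations.IsNonarchimedeanLocalField

namespace Literature.RepresentationTheory.HeisenbergGroup

/-! ## §1 `(M₁ ⊠ M₂)⁻¹ = M₁⁻¹ ⊠ M₂⁻¹` -/

section Box

variable {K : Type*} [Field K] [ValuativeRel K] [TopologicalSpace K] [IsNonarchimedeanLocalField K]
  {ι₁ ι₂ ι : Type*} [Fintype ι₁] [Fintype ι₂] [Fintype ι] (e : ι₁ ⊕ ι₂ ≃ ι)

/-- `(M₁ ⊠ M₂)⁻¹ = M₁⁻¹ ⊠ M₂⁻¹` as linear endomorphisms of `𝒮(K^ι)`. [cite: MoeglinVignerasWaldspurger1987, Chap. 2 II.1 Rem. (6)] -/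
theorem coe_boxEquivSB_symm_eq_sumEndSB (M₁ : SchwartzBruhat (ι₁ → K) ≃ₗ[ℂ] SchwartzBruhat (ι₁ → K))
    (M₂ : SchwartzBruhat (ι₂ → K) ≃ₗ[ℂ] SchwartzBruhat (ι₂ → K)) :
    ((boxEquivSB K e M₁ M₂).symm : SchwartzBruhat (ι → K) →ₗ[ℂ] SchwartzBruhat (ι → K)) =
      sumEndSB K e (M₁.symm : SchwartzBruhat (ι₁ → K) →ₗ[ℂ] SchwartzBruhat (ι₁ → K))
        (M₂.symm : SchwartzBruhat (ι₂ → K) →ₗ[ℂ] SchwartzBruhat (ι₂ → K)) :=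
  linearMap_ext_boxSB K e fun f₁ f₂ => by
    rw [LinearEquiv.coe_coe, sumEndSB_boxSB, LinearEquiv.coe_coe, LinearEquiv.coe_coe, LinearEquiv.symm_apply_eq,
      boxEquivSB_boxSB, LinearEquiv.apply_symm_apply, LinearEquiv.apply_symm_apply]

/-- `(M ⊠ 1) f = sumEndSB K e M id f`. [cite: MoeglinVignerasWaldspurger1987, Chap. 2 II.1 Rem. (6)] -/
theorem boxEquivSB_refl_apply (M : SchwartzBruhat (ι₁ → K) ≃ₗ[ℂ] SchwartzBruhat (ι₁ → K)) (f : SchwartzBruhat (ι → K)) :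
    boxEquivSB K e M (LinearEquiv.refl ℂ (SchwartzBruhat (ι₂ → K))) f =
      sumEndSB K e (M : SchwartzBruhat (ι₁ → K) →ₗ[ℂ] SchwartzBruhat (ι₁ → K)) LinearMap.id f := by
  rw [← LinearEquiv.coe_coe, coe_boxEquivSB_eq_sumEndSB]
  rfl

/-- `(M ⊠ 1)⁻¹ f = sumEndSB K e M⁻¹ id f`. [cite: MoeglinVignerasWaldspurger1987, Chap. 2 II.1 Rem. (6)] -/
theorem boxEquivSB_refl_symm_apply (M : SchwartzBruhat (ι₁ → K) ≃ₗ[ℂ] SchwartzBruhat (ι₁ → K))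
    (f : SchwartzBruhat (ι → K)) :
    (boxEquivSB K e M (LinearEquiv.refl ℂ (SchwartzBruhat (ι₂ → K)))).symm f =
      sumEndSB K e (M.symm : SchwartzBruhat (ι₁ → K) →ₗ[ℂ] SchwartzBruhat (ι₁ → K)) LinearMap.id f := by
  rw [← LinearEquiv.coe_coe, coe_boxEquivSB_symm_eq_sumEndSB]
  rfl

end Box

/-! ## §2 δ1 (δ1b) keyed on `boxEquivSB K e (piFourierEquivSB μ₁ hψ hm) 1`, eigen-identity in product order `g · ψ(b·Q₂) = l · g` -/

section Uncertainty

variable {K : Type*} [Field K] [ValuativeRel K] [TopologicalSpace K] [IsNonarchimedeanLocalField K]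
  {ι₁ ι₂ ι : Type*} [Fintype ι₁] [Fintype ι₂] [Fintype ι] (e : ι₁ ⊕ ι₂ ≃ ι)
  [MeasurableSpace (ι₁ → K)] [BorelSpace (ι₁ → K)] (μ₁ : Measure (ι₁ → K)) [μ₁.IsAddHaarMeasure]
  {ψ : AddChar K Circle} (hψ : ψ.IsContinuousNontrivial) {m : ℤ} (hm : ψ.HasConductorExp m)

/-- **INTEGRAL UNCERTAINTY, `(𝓕_{x′} ⊠ 1)⁻¹`-side, δ2-T shape.**  `f ∈ 𝒮(K^ι)` with (S) `ι₁`-support in `(𝔭^a)^{ι₁}`; (E) for every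
`b ∈ 𝒪` the function `g := (boxEquivSB K e 𝓕 1)⁻¹ f` satisfies `g y · ψ(b·Q₂(y|ι₁)) = l_b · g y`; (H) `Q₂` nowhere `𝔭^m`-constant along
`(𝔭^{m−a})^{ι₁}` ⟹ `f = 0`.  (★ `implements_partialWeyl_boxFourier` ∕ ★ `eigenvector_of_conj_weyl_unipotentSp_apply` produce exactly
this `ℱ` and this (E).) [cite: MoeglinVignerasWaldspurger1987, Chap. 2 II.6] [cite: WeilBNT1967, Chap. VII §2, Prop. 2] -/
theorem eq_zero_of_resL_support_subset_box_of_boxFourier_symm_eigen (Q₂ : (ι₁ → K) → K) {a : ℤ}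
    (f : SchwartzBruhat (ι → K)) (hS : ∀ x, (f : (ι → K) → ℂ) x ≠ 0 → resL e x ∈ piPrimePowBall K ι₁ a)
    (hE : ∀ b ∈ primePowBall K 0, ∃ l : ℂ, ∀ y,
      (((boxEquivSB K e (piFourierEquivSB μ₁ hψ hm) (LinearEquiv.refl ℂ (SchwartzBruhat (ι₂ → K)))).symm f :
            SchwartzBruhat (ι → K)) : (ι → K) → ℂ) y * ((ψ (b * Q₂ (resL e y)) : Circle) : ℂ) =
        l * (((boxEquivSB K e (piFourierEquivSB μ₁ hψ hm) (LinearEquiv.refl ℂ (SchwartzBruhat (ι₂ → K)))).symm f :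
            SchwartzBruhat (ι → K)) : (ι → K) → ℂ) y)
    (hH : ∀ η₀ : ι₁ → K, ∃ π ∈ piPrimePowBall K ι₁ (m - a), Q₂ (η₀ + π) - Q₂ η₀ ∉ primePowBall K m) :
    f = 0 := by
  refine eq_zero_of_resL_support_subset_box_of_partialFourier_symm_mulChar_eigen e μ₁ hψ hm Q₂ f hS (fun b hb => ?_) hH
  obtain ⟨l, hl⟩ := hE b hb
  refine ⟨l, fun y => ?_⟩
  rw [← boxEquivSB_refl_symm_apply, mul_comm]
  exact hl y

/-- **INTEGRAL UNCERTAINTY, `𝓕_{x′} ⊠ 1`-side, δ2-T shape** (forward orientation). [cite: MoeglinVignerasWaldspurger1987, Chap. 2 II.6]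
[cite: WeilBNT1967, Chap. VII §2, Prop. 2] -/
theorem eq_zero_of_resL_support_subset_box_of_boxFourier_eigen (Q₂ : (ι₁ → K) → K) {a : ℤ}
    (f : SchwartzBruhat (ι → K)) (hS : ∀ x, (f : (ι → K) → ℂ) x ≠ 0 → resL e x ∈ piPrimePowBall K ι₁ a)
    (hE : ∀ b ∈ primePowBall K 0, ∃ l : ℂ, ∀ y,
      ((boxEquivSB K e (piFourierEquivSB μ₁ hψ hm) (LinearEquiv.refl ℂ (SchwartzBruhat (ι₂ → K))) f :
            SchwartzBruhat (ι → K)) : (ι → K) → ℂ) y * ((ψ (b * Q₂ (resL e y)) : Circle) : ℂ) =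
        l * ((boxEquivSB K e (piFourierEquivSB μ₁ hψ hm) (LinearEquiv.refl ℂ (SchwartzBruhat (ι₂ → K))) f :
            SchwartzBruhat (ι → K)) : (ι → K) → ℂ) y)
    (hH : ∀ η₀ : ι₁ → K, ∃ π ∈ piPrimePowBall K ι₁ (m - a), Q₂ (η₀ + π) - Q₂ η₀ ∉ primePowBall K m) :
    f = 0 := by
  refine eq_zero_of_resL_support_subset_box_of_partialFourier_mulChar_eigen e μ₁ hψ hm Q₂ f hS (fun b hb => ?_) hH
  obtain ⟨l, hl⟩ := hE b hb
  refine ⟨l, fun y => ?_⟩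
  rw [← boxEquivSB_refl_apply, mul_comm]
  exact hl y

end Uncertainty

/-! ## §3 (EDITION 2) The road-δ ENDGAME: both root families with their natural parameter ranges `𝔭^{n₁}`, `𝔭^{n₂}` -/

section Endgame

variable {K : Type*} [Field K] [ValuativeRel K] [TopologicalSpace K] [IsNonarchimedeanLocalField K]
  {ι₁ ι₂ ι : Type*} [Fintype ι₁] [Fintype ι₂] [Fintype ι] (e : ι₁ ⊕ ι₂ ≃ ι)
  [MeasurableSpace (ι₁ → K)] [BorelSpace (ι₁ → K)] (μ₁ : Measure (ι₁ → K)) [μ₁.IsAddHaarMeasure]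
  {ψ : AddChar K Circle} (hψ : ψ.IsContinuousNontrivial) {m : ℤ} (hm : ψ.HasConductorExp m)

omit [Fintype ι₁] [Fintype ι₂] [Fintype ι] [MeasurableSpace (ι₁ → K)] [BorelSpace (ι₁ → K)] [μ₁.IsAddHaarMeasure] in
/-- reparametrising a root family: an eigen-identity for all `b ∈ 𝔭^{n}` under `ψ(b·Q)` is an eigen-identity for all `b₀ ∈ 𝒪` under
`ψ(b₀·(c Q))` when `|c| = q^{−n}` (`b = c b₀`). [cite: MoeglinVignerasWaldspurger1987, Chap. 2 II.6] -/
theorem forall_eigen_mul_of_forall_eigen {Y : Type*} (g : Y → ℂ) (Q : Y → K) {n : ℤ} {c : K} (hc : normAbs K c = ((residueFieldCard K : NNReal)⁻¹) ^ n)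
    (hE : ∀ b ∈ primePowBall K n, ∃ l : ℂ, ∀ y, g y * ((ψ (b * Q y) : Circle) : ℂ) = l * g y) :
    ∀ b₀ ∈ primePowBall K 0, ∃ l : ℂ, ∀ y, ((ψ (b₀ * (c * Q y)) : Circle) : ℂ) * g y = l * g y := by
  intro b₀ hb₀
  have hb : c * b₀ ∈ primePowBall K n := by
    rw [mul_mem_primePowBall_iff hc]; simpa using hb₀
  obtain ⟨l, hl⟩ := hE (c * b₀) hb
  refine ⟨l, fun y => ?_⟩
  rw [mul_comm (((ψ _ : Circle) : ℂ)), show b₀ * (c * Q y) = c * b₀ * Q y by ring]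
  exact hl y

include hm in
omit [Fintype ι₁] [Fintype ι₂] [Fintype ι] [MeasurableSpace (ι₁ → K)] [BorelSpace (ι₁ → K)] [μ₁.IsAddHaarMeasure] in
/-- **(S) from the Siegel-side root family and the torus**: if `f′` is an eigenvector of every `ψ(b·Q₁(x|ι₁))`, `b ∈ 𝔭^{n₁}`, its support
is stable under a map `φ` rescaling `Q₁(·|ι₁)` by `ν` with `|ν − 1| = 1` (the Levi dilation of δ2-T (V3)), and `c₁ Q₁ ξ ∈ 𝔭^m` forces
`ξ ∈ (𝔭^a)^{ι₁}` (`|c₁| = q^{−n₁}`; coercivity — ★ `UnramifiedBinaryNormValuation` for the unramified norm form), then the `ι₁`-support of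
`f′` lies in `(𝔭^a)^{ι₁}`. [cite: MoeglinVignerasWaldspurger1987, Chap. 2 II.6] -/
theorem resL_support_subset_box_of_root_eigen_of_levi_stable (Q₁ : (ι₁ → K) → K) {n₁ : ℤ} {c₁ : K}
    (hc₁ : normAbs K c₁ = ((residueFieldCard K : NNReal)⁻¹) ^ n₁) (f' : (ι → K) → ℂ)
    (hE₁ : ∀ b ∈ primePowBall K n₁, ∃ l : ℂ, ∀ x, f' x * ((ψ (b * Q₁ (resL e x)) : Circle) : ℂ) = l * f' x)
    (φ : (ι → K) → (ι → K)) (hφ : ∀ x, f' x ≠ 0 → f' (φ x) ≠ 0) {ν : K} (hQφ : ∀ x, Q₁ (resL e (φ x)) = ν * Q₁ (resL e x))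
    (hν : normAbs K (ν - 1) = 1) {a : ℤ} (hC : ∀ ξ : ι₁ → K, c₁ * Q₁ ξ ∈ primePowBall K m → ξ ∈ piPrimePowBall K ι₁ a) :
    ∀ x, f' x ≠ 0 → resL e x ∈ piPrimePowBall K ι₁ a := by
  intro x hx
  refine hC _ (forall_mem_primePowBall_of_mulChar_eigen_of_stable hm f' (fun x => c₁ * Q₁ (resL e x))
    (forall_eigen_mul_of_forall_eigen f' (fun x => Q₁ (resL e x)) hc₁ hE₁) φ hφ (ν := ν) (fun x => ?_) hν x hx)
  simp only [hQφ]; ring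

include hm in
/-- **THE ROAD-δ ENDGAME** (analytic half of (CORE′), splitting-free).  `f′ ∈ 𝒮(K^ι)` (`= M_g f`, the common eigenvector moved by the
Darboux mover), `ℱ = 𝓕_{x′} ⊠ 1 = boxEquivSB K e (piFourierEquivSB μ₁ hψ hm) 1`:
(E1) `f′` eigen under `ψ(b·Q₁(x|ι₁))` for all `b ∈ 𝔭^{n₁}` (Siegel-side roots, δ2-T (V1)); (D) its support stable under a `Q₁`-dilation by
`ν`, `|ν − 1| = 1` (torus, δ2-T (V3)); (C) `c₁Q₁ ξ ∈ 𝔭^m ⇒ ξ ∈ (𝔭^a)^{ι₁}`, `|c₁| = q^{−n₁}`; (E2) `ℱ⁻¹ f′` eigen under `ψ(b·Q₂(y|ι₁))` for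
all `b ∈ 𝔭^{n₂}` (Weyl-side roots, δ2-T (V2)); (H) `c₂Q₂` nowhere `𝔭^m`-constant along `(𝔭^{m−a})^{ι₁}`, `|c₂| = q^{−n₂}` (★ δ1 §6 from a
unit value and the parity `−n₂ + 2a = m + 1`) ⟹ `f′ = 0`. [cite: MoeglinVignerasWaldspurger1987, Chap. 2 II.6]
[cite: WeilBNT1967, Chap. VII §2, Prop. 2] -/
theorem eq_zero_of_root_eigen_of_weylRoot_eigen (Q₁ Q₂ : (ι₁ → K) → K) {n₁ n₂ : ℤ} {c₁ c₂ : K}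
    (hc₁ : normAbs K c₁ = ((residueFieldCard K : NNReal)⁻¹) ^ n₁) (hc₂ : normAbs K c₂ = ((residueFieldCard K : NNReal)⁻¹) ^ n₂)
    (f' : SchwartzBruhat (ι → K))
    (hE₁ : ∀ b ∈ primePowBall K n₁, ∃ l : ℂ, ∀ x,
      (f' : (ι → K) → ℂ) x * ((ψ (b * Q₁ (resL e x)) : Circle) : ℂ) = l * (f' : (ι → K) → ℂ) x)
    (φ : (ι → K) → (ι → K)) (hφ : ∀ x, (f' : (ι → K) → ℂ) x ≠ 0 → (f' : (ι → K) → ℂ) (φ x) ≠ 0) {ν : K}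
    (hQφ : ∀ x, Q₁ (resL e (φ x)) = ν * Q₁ (resL e x)) (hν : normAbs K (ν - 1) = 1)
    {a : ℤ} (hC : ∀ ξ : ι₁ → K, c₁ * Q₁ ξ ∈ primePowBall K m → ξ ∈ piPrimePowBall K ι₁ a)
    (hE₂ : ∀ b ∈ primePowBall K n₂, ∃ l : ℂ, ∀ y,
      (((boxEquivSB K e (piFourierEquivSB μ₁ hψ hm) (LinearEquiv.refl ℂ (SchwartzBruhat (ι₂ → K)))).symm f' :
            SchwartzBruhat (ι → K)) : (ι → K) → ℂ) y * ((ψ (b * Q₂ (resL e y)) : Circle) : ℂ) =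
        l * (((boxEquivSB K e (piFourierEquivSB μ₁ hψ hm) (LinearEquiv.refl ℂ (SchwartzBruhat (ι₂ → K)))).symm f' :
            SchwartzBruhat (ι → K)) : (ι → K) → ℂ) y)
    (hH : ∀ η₀ : ι₁ → K, ∃ π ∈ piPrimePowBall K ι₁ (m - a), c₂ * Q₂ (η₀ + π) - c₂ * Q₂ η₀ ∉ primePowBall K m) :
    f' = 0 := by
  have hS := resL_support_subset_box_of_root_eigen_of_levi_stable e hm Q₁ hc₁ f' hE₁ φ hφ hQφ hν hC
  refine eq_zero_of_resL_support_subset_box_of_boxFourier_symm_eigen e μ₁ hψ hm (fun ξ => c₂ * Q₂ ξ) f' hS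
    (fun b₀ hb₀ => ?_) hH
  obtain ⟨l, hl⟩ := forall_eigen_mul_of_forall_eigen _ (fun y => Q₂ (resL e y)) hc₂ hE₂ b₀ hb₀
  exact ⟨l, fun y => by rw [mul_comm]; exact hl y⟩

end Endgame

end Literature.RepresentationTheory.HeisenbergGroup
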